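/-
Copyright (c) 2026. All rights reserved.
Released under Apache 2.0 license as described in the file LICENSE.
Authors: abc-iut cell, seat abc-iut-w5-d050 (gen 5).
-/
import Literature.GroupTheory.ProSigmaPowerMap
import Literature.AnabelianGeometry.SemiGraphs.PSCFundamentalGroup
import Literature.AnabelianGeometry.Anabelioids.ProSigma

/-!
# Pro-`Σ` PSC-fundamental groups: ABSTRACT finite quotients are `Σ`-groups

Bridge from the Mathlib-only file `Literature/GroupTheory/ProSigmaPowerMap.lean` to the cell's
vocabulary `IsProSigma Σ Π` ([CombGC] Def. 1.1 (ii), `PSCFundamentalGroup.lean`) and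
`Anabelioids.IsSigmaInteger` ([SemiAnbd] Def. 2.9 (i), `Anabelioids/ProSigma.lean`): for a PROFINITE
(compact, totally disconnected) pro-`Σ` group `Π`,

* `IsProSigma.isSigmaInteger_index_of_finiteIndex` — the index of EVERY subgroup of finite index —
  closed or not — is a
  `Σ`-integer (the definition only speaks of OPEN normal subgroups; S. Mochizuki, *Semi-graphs of
  anabelioids*, Def. 2.9; J. D. Dixon et al., *Analytic pro-`p` groups*, Lemma 1.18 for `Σ = {p}`);
* `IsProSigma.prime_mem_of_dvd_index`, `IsProSigma.pow_bijective` — the unfolded forms.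

Proof-only; no new definitions. [cite: DixonEtAl1999, §1.3 Lemma 1.18]
-/

namespace Literature.AnabelianGeometry.SemiGraphs

open Literature.AnabelianGeometry.Anabelioids (IsSigmaInteger)

universe u

variable {P : Type u} [Group P] [TopologicalSpace P] [IsTopologicalGroup P] [CompactSpace P]
  [TotallyDisconnectedSpace P] {Sigma : Set ℕ}

omit [TotallyDisconnectedSpace P] in
/-- The `IsProSigma` field, read as the hypothesis shape of `Literature.GroupTheory.ProSigma.*`: for a
compact group every open normal subgroup has finite quotient, and `index = Nat.card` of the quotient.
[cite: MochizukiCombGC2007, Def 1.1(ii) p.6] -/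
theorem IsProSigma.prime_mem_of_dvd_index_openNormalSubgroup (hP : IsProSigma Sigma P)
    (U : OpenNormalSubgroup P) {q : ℕ} (hq : q.Prime) (hdvd : q ∣ (U : Subgroup P).index) :
    q ∈ Sigma := by
  haveI : Finite (P ⧸ U.toSubgroup) := Subgroup.quotient_finite_of_isOpen U.toSubgroup U.isOpen
  exact hP.prime_mem U this q hq (by rwa [← Subgroup.index_eq_card])

/-- **Abstract finite quotients of a profinite pro-`Σ` group are `Σ`-groups**: every prime dividing the
index of an ARBITRARY (not necessarily closed) subgroup of finite index lies in `Σ`.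
[cite: DixonEtAl1999, §1.3 Lemma 1.18] -/
theorem IsProSigma.prime_mem_of_dvd_index (hP : IsProSigma Sigma P) (K : Subgroup P) [K.FiniteIndex]
    {q : ℕ} (hq : q.Prime) (hdvd : q ∣ K.index) : q ∈ Sigma :=
  Literature.GroupTheory.ProSigma.prime_mem_of_dvd_index
    (fun U _ hq' hd' => hP.prime_mem_of_dvd_index_openNormalSubgroup U hq' hd') K hq hdvd

/-- The index of an ARBITRARY finite-index subgroup of a profinite pro-`Σ` group is a `Σ`-integer
([SemiAnbd] Def. 2.9 (i)) — removes the openness hypothesis of abc-iut-L3-t4's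
`IsProSigma.isSigmaInteger_index` (`ProSigmaSubquotients.lean`, open subgroups only).
[cite: MochizukiSemiAnbd2006, Def. 2.9(i) p.31] -/
theorem IsProSigma.isSigmaInteger_index_of_finiteIndex (hP : IsProSigma Sigma P) (K : Subgroup P) [K.FiniteIndex] :
    IsSigmaInteger Sigma K.index :=
  Literature.GroupTheory.ProSigma.index_pos_and_prime_mem
    (fun U _ hq' hd' => hP.prime_mem_of_dvd_index_openNormalSubgroup U hq' hd') K

/-- The `n`-power map of a profinite pro-`Σ` group is a bijection for every `n` with no prime factor in
`Σ`. [cite: DixonEtAl1999, §1.3 Lemma 1.18] -/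
theorem IsProSigma.pow_bijective (hP : IsProSigma Sigma P) {n : ℕ}
    (hn : ∀ q ∈ Sigma, q.Prime → ¬ q ∣ n) : Function.Bijective fun x : P => x ^ n :=
  Literature.GroupTheory.ProSigma.pow_bijective
    (fun U _ hq' hd' => hP.prime_mem_of_dvd_index_openNormalSubgroup U hq' hd') hn

/-- In particular (abstract version of `IsProSigma` itself): for every normal subgroup `N` of finite
index — open or not — every prime dividing `Nat.card (Π ⧸ N)` lies in `Σ`.
[cite: MochizukiCombGC2007, Def 1.1(ii) p.6] -/
theorem IsProSigma.prime_mem_of_dvd_card_quotient (hP : IsProSigma Sigma P) (N : Subgroup P)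
    [N.Normal] [N.FiniteIndex] {q : ℕ} (hq : q.Prime) (hdvd : q ∣ Nat.card (P ⧸ N)) : q ∈ Sigma :=
  hP.prime_mem_of_dvd_index N hq (by rwa [Subgroup.index_eq_card])

end Literature.AnabelianGeometry.SemiGraphs
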